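import Summits.ValiantsHypothesis.ValiantsHypothesis.Theorems.PolyaContinuedMonotoneCoverHardMixingBet

/-!
# Crux `MonotoneCoverHard` (stmt-ValiantsHypothesis-7421, route PolyaContinued, rank 2) — skeleton of
line `width-mixing` (PREPARED by prover val-width-7421-p4 g0, 2026-08-28; NOT registered — registering
it would replace the active line `width_cut` v2, a planner / director decision)

SHARPENING of the registered line `width_cut` v2 (one stub `stub_width` = the width bet).  Everything
below is in the tree (`Theorems/PolyaContinuedMonotoneCoverHard*.lean`, ns
`…Theorems.PolyaContinuedMonotoneCoverHard`):

* `monotoneCoverHard_of_widthBet : WidthBet → MonotoneCoverHard` (val-width-7421-p2, `…WidthBet`);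
* **`widthBet_of_mixingWidthBet : MixingWidthBet → WidthBet`** and
  **`monotoneCoverHard_of_mixingWidthBet : MixingWidthBet → MonotoneCoverHard`** (val-width-7421-p4,
  `…MixingBet`), where `MixingWidthBet` is the width bet RESTRICTED TO LEVEL-MIXING COVERS — covers with
  two weight-nonzero perfect matchings reading the same variable `x_{kl}` at two different row levels.
  Reason: covers that are label-levelled on their used edges are row- or column-levelled
  (`rowLevelled_or_colLevelled_of_labelLevelled`, exchange identity + "cells meeting every permutation
  equally are a union of rows or of columns"), and those have ALL widths `≤ 2`
  (`width_le_two_of_rowLevelled` / `…colLevelled`, from `false_of_pure_fiber`: a PURE fiber has width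
  `≤ 2`, by the fiber substitution `x ↦ x / 1 / 0` and the level-free one-level engine
  `no_pfaffian_cover_of_idleSplit` — Pólya signing, unimodular idle blocks, two constant-pivot Schur
  steps, Mignon–Ressayre), so they satisfy the bet's conclusion outright (`exists_balanced_level`,
  `varCount_eq`, `belowCount_eq`).
* Rungs in kernel: the crux HOLDS for graded covers (`no_quasipolynomial_graded_cover`), width-≤-2
  covers (`no_quasipolynomial_width_two_cover`), row- or column-levelled covers
  (`no_quasipolynomial_rowLevelled_cover` / `…colLevelled…`) and label-levelled covers
  (`no_quasipolynomial_labelLevelled_cover`) — every cover in print (Grenet, ABP / decision tree,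
  Laplace, `K_{2,2}`-blocks) is label-levelled.
* Structural non-Pfaffian theorems in kernel (any size `m`): one level (`no_oneLevel_pfaffian_cover`),
  three hard lanes (`no_threeHardLanes_pfaffian_cover`), permanent tokens
  (`no_permanentTokens_pfaffian_cover`), lane sets / trio-as-a-set (`no_laneSet_pfaffian_cover` and its
  column / label-column transposes), pure fibers (`false_of_pure_fiber`, `false_of_fiber_lanes`), and
  the quantitative forms `sq_le_two_mul_card_activeRows`, `sq_le_two_mul_card_fiberRows` (every
  `T`-fiber spreads its `T`-labels over `≥ #T²/2` rows).

So this skeleton is two lines long: the crux follows BY NAME from the single stub `stub_width_mixing`.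
Content of the bet: a LEVEL-MIXING label-bijective Pfaffian cover still has a balanced level of
polylog width.  The enemy is now named precisely: the same variable read at two levels (equivalently,
by the exchange facts, two edges with the same label at different levels on one alternating cycle).
First falsifier: ANY label-bijective Pfaffian cover of `per_n`, `n ≥ 3`, with a level of width `≥ 3`
— by `false_of_pure_fiber` such a level must mix; refuter `val-width-7421-d1` is searching
`per_3 / per_4`, `m ≤ 12`.  Calibration (honest): `MonotoneCoverHard` is OPEN, exactly for level-mixing
covers; VP ≠ VNP is not moved by this file.
-/

set_option linter.dupNamespace false

namespace Summit.ValiantsHypothesis.ValiantsHypothesis.Cruxes.MonotoneCoverHard.WidthMixing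

open Summit.ValiantsHypothesis.ValiantsHypothesis.Theses.PolyaContinued
open Summit.ValiantsHypothesis.ValiantsHypothesis.Theorems.PolyaContinuedMonotoneCoverHard
  (monotoneCoverHard_of_mixingWidthBet)
open Literature.Computability.AlgebraicComplexity (perPoly)
open scoped Classical

/-- STUB — THE MIXING WIDTH BET: uniformly (`∃ d n₀`), for every label-bijective Pfaffian cover of
`per_n`, `n ≥ n₀`, on `m + m` vertices, every level function `g` on its used edges, and PROVIDED the
cover is LEVEL-MIXING (two weight-nonzero perfect matchings `τ, τ'` read the same variable `x_v` at rows
`i, i'` of different levels), some level `h ≥ 1` is balanced with widths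
`c_h + c_{h-1} ≤ (log₂ m + d)^d`.  (Verbatim the hypothesis of `monotoneCoverHard_of_mixingWidthBet`.) -/
theorem stub_width_mixing :
    ∃ d n₀ : ℕ, ∀ (n m : ℕ) (E : Finset (Fin m × Fin m))
  (a : Fin m × Fin m → MvPolynomial (Fin n × Fin n) ℂ), n₀ ≤ n →
  (∃ s : Fin m × Fin m → ℂ, (∀ e, s e = 1 ∨ s e = -1) ∧
    (Matrix.of fun i j => if (i, j) ∈ E then MvPolynomial.C (s (i, j)) * MvPolynomial.X (i, j)
        else 0 : Matrix (Fin m) (Fin m) (MvPolynomial (Fin m × Fin m) ℂ)).det =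
      (Matrix.of fun i j => if (i, j) ∈ E then MvPolynomial.X (i, j) else 0 :
        Matrix (Fin m) (Fin m) (MvPolynomial (Fin m × Fin m) ℂ)).permanent) →
  (∀ e, (∃ j, a e = MvPolynomial.X j) ∨ a e = 0 ∨ a e = 1) →
  perPoly (Fin n) ℂ =
    MvPolynomial.aeval a (Matrix.of fun i j => if (i, j) ∈ E then MvPolynomial.X (i, j) else 0 :
        Matrix (Fin m) (Fin m) (MvPolynomial (Fin m × Fin m) ℂ)).permanent →
  ∀ g : Fin m ⊕ Fin m → ℕ,
    (∀ τ : Equiv.Perm (Fin m), (∀ i, (i, τ i) ∈ E ∧ a (i, τ i) ≠ 0) → ∀ i,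
      (∃ k, a (i, τ i) = MvPolynomial.X k) → g (Sum.inr (τ i)) = g (Sum.inl i) + 1) →
    (∀ τ : Equiv.Perm (Fin m), (∀ i, (i, τ i) ∈ E ∧ a (i, τ i) ≠ 0) → ∀ i,
      (¬ ∃ k, a (i, τ i) = MvPolynomial.X k) → g (Sum.inr (τ i)) = g (Sum.inl i)) →
    (∃ τ τ' : Equiv.Perm (Fin m), (∀ i, (i, τ i) ∈ E ∧ a (i, τ i) ≠ 0) ∧
      (∀ i, (i, τ' i) ∈ E ∧ a (i, τ' i) ≠ 0) ∧ ∃ (i i' : Fin m) (v : Fin n × Fin n),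
        a (i, τ i) = MvPolynomial.X v ∧ a (i', τ' i') = MvPolynomial.X v ∧
        g (Sum.inl i) ≠ g (Sum.inl i')) →
    ∃ h ch cq : ℕ, 1 ≤ h ∧
      (∀ τ : Equiv.Perm (Fin m), (∀ i, (i, τ i) ∈ E ∧ a (i, τ i) ≠ 0) →
        n ≤ 3 * (Finset.univ.filter fun i : Fin m =>
            (∃ k, a (i, τ i) = MvPolynomial.X k) ∧ g (Sum.inl i) < h).card ∧
          3 * (Finset.univ.filter fun i : Fin m =>
            (∃ k, a (i, τ i) = MvPolynomial.X k) ∧ g (Sum.inl i) < h).card ≤ 2 * n) ∧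
      (∀ τ : Equiv.Perm (Fin m), (∀ i, (i, τ i) ∈ E ∧ a (i, τ i) ≠ 0) →
        (Finset.univ.filter fun i : Fin m =>
          (∃ k, a (i, τ i) = MvPolynomial.X k) ∧ g (Sum.inl i) = h).card = ch) ∧
      (∀ τ : Equiv.Perm (Fin m), (∀ i, (i, τ i) ∈ E ∧ a (i, τ i) ≠ 0) →
        (Finset.univ.filter fun i : Fin m =>
          (∃ k, a (i, τ i) = MvPolynomial.X k) ∧ g (Sum.inl i) = h - 1).card = cq) ∧
      ch + cq ≤ (Nat.log 2 m + d) ^ d := by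
  sorry

/-- THE PIECE `MonotoneCoverHard` BY NAME from the single stub. -/
theorem MonotoneCoverHard_of : MonotoneCoverHard :=
  monotoneCoverHard_of_mixingWidthBet stub_width_mixing

end Summit.ValiantsHypothesis.ValiantsHypothesis.Cruxes.MonotoneCoverHard.WidthMixing
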